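import Summits.Ventures.CertifiedManyBodySolver.Certificates.HubbardSquare_transportClosure_Kit
import Literature.MathematicalPhysics.QuantumLattice.HubbardTTPrimeChemicalPotentialFloors
import HarnessLib

/-!
# Ventures/CertifiedManyBodySolver — Certificates/HubbardSquare_transportClosure_KitS.lean
# (hubbard-fast-reuse-5 g3, cell hubbard-fast, D-0154 (A) CERTIFICATE REUSE: the TRANSPORT-CLOSURE kit, part 5 = `n`-SHEET (`μ`-floor)
# inputs for the `t'`-line laws of part 3 `…_KitT.lean`; parts 1/2 = hubbard-fast-reuse-1's `…_Kit.lean` / `…_KitLaws.lean`,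
# part 4 = `…_KitPh.lean`; captain p1 g31 RULINGS #55 / #84 / #92 (2) / #96 — wave-3 row folds S1/S5/S9/S2)

A producer row of the cell arrives as an `n`-SHEET = a `μ`-floor `(c, μ)` at one anchor `(t' = s₀, U = U₀)`:
`c + μ·m ≤ e₀(t, s₀, U₀, m)` for EVERY density `0 ≤ m < 2` (the certificate's dual with the density row's multiplier moved to
the right-hand side; Literature `HubbardTTPrimeChemicalPotentialFloors`, §1). The fold owner cites it BY VALUE as a hypothesis
`(hsX… : ∀ m : ℝ, 0 ≤ m → m < 2 → c + μ * m ≤ energyDensityTT' 1 s₀ U₀ m)` (CANDIDATE until the row's certificate is replayed).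
This file turns such a sheet into the INPUT SHAPES of the kit's one-step laws, with no loss except where a law says so:
* `tc_sheetT_floor` — the sheet read as a bilinear `(U, n)`-floor AT ITS OWN `t' = s₀` on any rectangle `[U₁,U₂] × [n₁,n₂]` with
  `U₀ ≤ U₁` (`e₀` non-decreasing in `U`, `gcFloor_mono_U`): exactly the `hA`/`hB` input of `tc_mlFloor_tchord` and of
  `tc_mlCap_tsecx_above/below` (part 3) — so a sheet is a `t'`-CHORD partner and a far-end floor for `t'`-SECANT caps;
* `tc_sheetT_floor_phImage` — the same sheet read at the MIRROR hopping `t' = -s₀` through the exact particle–hole map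
  `e(t,-s,U,n) = e(t,s,U,2-n) + U(n-1)` (`energyDensityTT'_particleHole'`): bilinear floor `(c + 2μ) - U - μ n + U n`;
* `tc_mlFloor_sheet_tdrift_below` / `…_above` — ONE-SHEET `t'`-DRIFT floors (no partner needed): at `t' = θ1` on the side
  `θ1 ≤ s₀` (resp. `θ1 ≥ s₀`) and `U ≥ U₀` the sheet survives with its slope lowered by `4|θ1 - s₀|`
  (`gcFloor_of_tPrime`, `|e(s,m) - e(s',m)| ≤ 4m|s - s'|`), written directly as an 8-coefficient floor on the target cell.
HONEST FRAMING: bookkeeping adapters; they certify nothing by themselves; every consumer word inherits exactly the sheet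
hypotheses it cites (producer-certified CANDIDATE rows until replayed); no number of record; not a phase word; no summit statement
is proved here; not a superconductivity verdict.
-/

namespace Summit.Ventures.CertifiedManyBodySolver.Certificates

open Literature.MathematicalPhysics.QuantumLattice
open Literature.MathematicalPhysics.QuantumLattice.ThermodynamicLimit
open Set

/-! ### §1 A sheet as a `t'`-slice input (bilinear `(U, n)`-floor at fixed `t'`) -/

/-- **Sheet ⇒ bilinear floor at its own `t'`.** A `μ`-floor `(c, μ)` at `(s₀, U₀)`, `U₀ ≥ 0`, is the bilinear floor
`c + 0·U + μ·n + 0·U·n ≤ e(t, s₀, U, n)` on every rectangle `[U₁, U₂] × [n₁, n₂]` with `U₀ ≤ U₁`, `0 ≤ n₁`, `n₂ < 2`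
(`gcFloor_mono_U`). This is the `hA`/`hB` input shape of `tc_mlFloor_tchord` / `tc_mlCap_tsecx_above/below`.
[cite: Ruelle1969, §3.4] -/
theorem tc_sheetT_floor (t : ℝ) {s₀ U₀ c μ U₁ U₂ n₁ n₂ : ℝ}
    (hc : ∀ m : ℝ, 0 ≤ m → m < 2 → c + μ * m ≤ energyDensityTT' t s₀ U₀ m)
    (hU₀ : 0 ≤ U₀) (hU₁ : U₀ ≤ U₁) (hn₁ : 0 ≤ n₁) (hn₂ : n₂ < 2) :
    ∀ U n : ℝ, U₁ ≤ U → U ≤ U₂ → n₁ ≤ n → n ≤ n₂ →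
      c + 0 * U + μ * n + 0 * U * n ≤ energyDensityTT' t s₀ U n := by
  intro U n k1 _ k5 k6
  have h := gcFloor_mono_U t s₀ hU₀ (hU₁.trans k1) hc (hn₁.trans k5) (lt_of_le_of_lt k6 hn₂)
  linarith

/-- **Sheet ⇒ bilinear floor at the mirror hopping `-s₀` (exact particle–hole image).** A `μ`-floor `(c, μ)` at `(s₀, U₀)`,
`U₀ ≥ 0`, gives at the mirror hopping `s₁ = -s₀` (stated as `s₀ + s₁ = 0` so that a literal `s₁` unifies) on every rectangle
`[U₁, U₂] × [n₁, n₂]` with `U₀ ≤ U₁`, `0 < n₁`, `n₂ < 2` the bilinear floor `(c + 2μ) + (-1)·U + (-μ)·n + 1·U·n ≤ e(t, s₁, U, n)`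
(`e(t,-s,U,n) = e(t,s,U,2-n) + U(n-1)` and the sheet at density `2 - n`).
[cite: LiebWuPhysicaA2003, §1 eq. (3)] -/
theorem tc_sheetT_floor_phImage (t : ℝ) {s₀ U₀ c μ s₁ U₁ U₂ n₁ n₂ : ℝ}
    (hc : ∀ m : ℝ, 0 ≤ m → m < 2 → c + μ * m ≤ energyDensityTT' t s₀ U₀ m)
    (hU₀ : 0 ≤ U₀) (hs₁ : s₀ + s₁ = 0) (hU₁ : U₀ ≤ U₁) (hn₁ : 0 < n₁) (hn₂ : n₂ < 2) :
    ∀ U n : ℝ, U₁ ≤ U → U ≤ U₂ → n₁ ≤ n → n ≤ n₂ →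
      (c + 2 * μ) + (-1) * U + (-μ) * n + 1 * U * n ≤ energyDensityTT' t s₁ U n := by
  intro U n k1 _ k5 k6
  have hn0 : 0 < n := lt_of_lt_of_le hn₁ k5
  have hn2 : n < 2 := lt_of_le_of_lt k6 hn₂
  have hU : 0 ≤ U := hU₀.trans (hU₁.trans k1)
  have es : s₁ = -s₀ := by linarith
  have hph := energyDensityTT'_particleHole' t s₀ hU hn0 hn2
  have h := gcFloor_mono_U t s₀ hU₀ (hU₁.trans k1) hc (n := 2 - n) (by linarith) (by linarith)
  rw [es, hph]
  linarith

/-! ### §2 One-sheet `t'`-drift floors (slope loss `4|Δt'|`, no partner) -/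

/-- **One-sheet `t'`-DRIFT floor, below the anchor hopping.** A `μ`-floor `(c, μ)` at `(s₀, U₀)`, `U₀ ≥ 0`, gives on every cell
`[Ua, Ub] × [sa, sb] × [n₁, n₂]` with `U₀ ≤ Ua`, `sb ≤ s₀`, `0 ≤ n₁`, `n₂ < 2` the 8-coefficient floor
`c + (μ - 4 s₀)·θ2 + 4·θ1·θ2 ≤ e(t, θ1, θ0, θ2)` (i.e. `c + (μ - 4(s₀ - θ1))·θ2`: `gcFloor_mono_U` then `gcFloor_of_tPrime`).
[cite: Israel1979, Thm. I.3.4] -/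
theorem tc_mlFloor_sheet_tdrift_below (t : ℝ) {s₀ U₀ c μ Ua Ub sa sb n₁ n₂ : ℝ}
    (hc : ∀ m : ℝ, 0 ≤ m → m < 2 → c + μ * m ≤ energyDensityTT' t s₀ U₀ m)
    (hU₀ : 0 ≤ U₀) (hUa : U₀ ≤ Ua) (hsb : sb ≤ s₀) (hn₁ : 0 ≤ n₁) (hn₂ : n₂ < 2) :
    ∀ θ ∈ Set.Icc (![Ua, sa, n₁] : Fin 3 → ℝ) ![Ub, sb, n₂],
      c + 0 * θ 0 + 0 * θ 1 + (μ - 4 * s₀) * θ 2 + 0 * θ 0 * θ 1 + 0 * θ 0 * θ 2 + 4 * θ 1 * θ 2 +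
        0 * θ 0 * θ 1 * θ 2 ≤ energyDensityTT' t (θ 1) (θ 0) (θ 2) := by
  intro θ hθ
  obtain ⟨⟨k1, _⟩, ⟨_, k4⟩, ⟨k5, k6⟩⟩ := mem_Icc_vec3_iff.1 hθ
  have hn0 : 0 ≤ θ 2 := hn₁.trans k5
  have hn2 : θ 2 < 2 := lt_of_le_of_lt k6 hn₂
  have hU : 0 ≤ θ 0 := hU₀.trans (hUa.trans k1)
  have hcU : ∀ m : ℝ, 0 ≤ m → m < 2 → c + μ * m ≤ energyDensityTT' t s₀ (θ 0) m :=
    fun m hm0 hm2 => gcFloor_mono_U t s₀ hU₀ (hUa.trans k1) hc hm0 hm2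
  have h := gcFloor_of_tPrime t hU (s := s₀) (s' := θ 1) hcU hn0 hn2
  have habs : |θ 1 - s₀| = s₀ - θ 1 := by
    rw [abs_of_nonpos (by linarith)]; ring
  rw [habs] at h
  linarith

/-- **One-sheet `t'`-DRIFT floor, above the anchor hopping.** Same data with `s₀ ≤ sa`: the 8-coefficient floor
`c + (μ + 4 s₀)·θ2 - 4·θ1·θ2 ≤ e(t, θ1, θ0, θ2)` on `[Ua, Ub] × [sa, sb] × [n₁, n₂]`. [cite: Israel1979, Thm. I.3.4] -/
theorem tc_mlFloor_sheet_tdrift_above (t : ℝ) {s₀ U₀ c μ Ua Ub sa sb n₁ n₂ : ℝ}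
    (hc : ∀ m : ℝ, 0 ≤ m → m < 2 → c + μ * m ≤ energyDensityTT' t s₀ U₀ m)
    (hU₀ : 0 ≤ U₀) (hUa : U₀ ≤ Ua) (hsa : s₀ ≤ sa) (hn₁ : 0 ≤ n₁) (hn₂ : n₂ < 2) :
    ∀ θ ∈ Set.Icc (![Ua, sa, n₁] : Fin 3 → ℝ) ![Ub, sb, n₂],
      c + 0 * θ 0 + 0 * θ 1 + (μ + 4 * s₀) * θ 2 + 0 * θ 0 * θ 1 + 0 * θ 0 * θ 2 + (-4) * θ 1 * θ 2 +
        0 * θ 0 * θ 1 * θ 2 ≤ energyDensityTT' t (θ 1) (θ 0) (θ 2) := by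
  intro θ hθ
  obtain ⟨⟨k1, _⟩, ⟨k3, _⟩, ⟨k5, k6⟩⟩ := mem_Icc_vec3_iff.1 hθ
  have hn0 : 0 ≤ θ 2 := hn₁.trans k5
  have hn2 : θ 2 < 2 := lt_of_le_of_lt k6 hn₂
  have hU : 0 ≤ θ 0 := hU₀.trans (hUa.trans k1)
  have hcU : ∀ m : ℝ, 0 ≤ m → m < 2 → c + μ * m ≤ energyDensityTT' t s₀ (θ 0) m :=
    fun m hm0 hm2 => gcFloor_mono_U t s₀ hU₀ (hUa.trans k1) hc hm0 hm2
  have h := gcFloor_of_tPrime t hU (s := s₀) (s' := θ 1) hcU hn0 hn2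
  have habs : |θ 1 - s₀| = θ 1 - s₀ := abs_of_nonneg (by linarith)
  rw [habs] at h
  linarith

end Summit.Ventures.CertifiedManyBodySolver.Certificates
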